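import Summits.QuantumFields.BalabanUV.Beta.FP.TowerHN1Row
import Summits.QuantumFields.BalabanUV.Beta.FP.TorusCompositeIndexWardOneSym
import Summits.QuantumFields.BalabanUV.Beta.FP.TorusCompositeCovarianceTwoPolarSym

/-!
# `BalabanUV.Beta.FP.TowerQN1RowJet` — road «FP», binder row D1, ROUTE T (β1), (E4e) PART 1∕2: **THE END WRAPPER's 𝔔-SIDE FIRST-ORDER LETTERS ARE leaf-02 C2-Sym's
# (n+2)-FOLD COMPOSITE JET, AND THE CONJUGATED JET RUNS ALONG `r • colN̂`** — v4's `hQ₁₀ hQ₂₀ hQ₁₁f hQ₂₁f h𝔔₀ h𝔔₁` give `𝔔₁f v = c • compIns₁Sym … (n+2) (hv v)`,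
# `𝔔₀ = compRowsSym … (n+2)`; with R-FP-79's free read-out INSTANTIATED as `Xbf v := c • diagonal (lv v ∘ itRoot^{ρ_c} (n+2) ∘ fst)` (an2 g66 J-NOTE-4 ∕ R-D1-g66-1 (iii)),
# an2 g66's sym pure-gauge law makes `𝔔′₁f v = c • compIns₁Sym … (hv v + tgrad·lv v)` (NO gauge residue), and (J-W″) at `r := 1` + homogeneity make the direction
# `hv (r•e_a) + tgrad·lv (r•e_a) = r • colN̂_a`

WHY (`HOME/b2b-balaban-beta-d1-p3/g42/SPEC-53.md`; an2 g66 J-NOTE-4 l.67584 ∕ A-1 l.67586, steps (E4e-1)(E4e-2); §1–§2 ADAPT the row's NOT-TO-FILE certificate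
`HOME/b2b-balaban-beta-an2/gen66/cert/J4-Qside-chain-is-compIns1Sym.NOT-TO-FILE.lean` fcb8f993af7598be (a)(b)(e)(f) and probe `J4g-…` 301dc50930202d9e (g), with credit —
source type `κ` generic).  The assembly with F4-Sym, the slot bridge, an2 PART 11∕12 and the lock scalar is `FP/TowerQN1Row`.

WHAT ([folklore] `Matrix`∕`Finset` bookkeeping BY NAME; no `def`, no `def … : Prop`, nothing cited, 0 sorry): §1 `Qf1_eq_compIns1Sym` (J-NOTE-4 (a): the five letters →
`c • compIns₁Sym Lc M (fun i => n+1−(i−1)) ρ_c (n+2) (hv v)`, top peel `rfl`), `Q0_eq_compRowsSym` ((e)), `unit_eq_sigmaFull` ((b)), `sigmaFull_card_eq` (`#B = Lc⁴`);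
§2 `Qprime1_eq_jet_along_sum_of_pureGauge` ((f), abstract jet `CI ∕ CRS` with `hPG ∕ hadd`), **`Qprime1_eq_compIns1Sym_along_sum`** ((g): `hPG ∕ hadd` DISCHARGED by
an2 g66 `TorusCompositeIndexWardOneSym.compIns₁Sym_pureGauge_fun` + leaf-02 `TorusCompositeCovarianceTwoPolarSym.compIns₁Sym_add`, read at the wrapper's spelling
`towerTorus Lc (fine Lc M) (n+1)` of `towerTorus Lc M (n+2)`), **`direction_add_exact_eq_smul_col`** ((J-W″) as a sum: `hv (r•e_a) + tgrad·lv (r•e_a) = r • colN̂_a`).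
WHAT THIS IS NOT: not `hQN₁` (the assembly `FP/TowerQN1Row`); not `hJW`'s instantiation (g39 #5); nothing of Bałaban's asserted, valued or discharged; 0 estimates; 0∕4 row-D1
binders (hW, hR, D1Tel, D1Rep); ROOT M‴ p325680 ∕ P5c ∕ D6 untouched; NOT (C1), NOT (L2′), NOT (T-ID), NOT SDF, NOT D1, NEVER «G-an2-4 closed», NOT BetaPertH, NOT continuum,
NOT Clay.

HONEST DEPENDENCY (page 1, mandatory): continuum YM on T⁴ ⇐ BetaPertH ∧ nine spine estimates (0/9 proved); BetaPertH ⇐ (D1) ∧ (D4) ∧ CAP+tail;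
G-an2-4 gates asym, D1 and NE2/3/4.  HONEST FRAMING (cell contract, verbatim): «discharging `BetaPertH` makes Bałaban's UV stability UNCONDITIONAL —
a real constructive-QFT result; it is NOT the continuum limit and NOT the Clay problem.»  ABSOLUTE RULE (cell charter, verbatim): «No internally-minted
statement may enter as a cited fact. Every hypothesis is either kernel-proved in this package or a verbatim quotation of a PUBLISHED theorem with page
reference. The manuscript(s) under audit are NOT citable for their own disputed steps — they are the thing under adjudication; programme-internal
(2001/route/tribunal) claims are never citable.»  Road «FP» OWNER, b2b-balaban-beta-d1-p3 gen 42, 2026-08-27.  No existing file touched.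
-/

noncomputable section

open scoped BigOperators

namespace Summit.QuantumFields.BalabanUV.Beta.FP.TowerQN1RowJet

open Finset Matrix
open Literature.MathematicalPhysics.QuantumFieldTheory
open Literature.MathematicalPhysics.QuantumFieldTheory.Balaban1983to89
open Literature.MathematicalPhysics.QuantumFieldTheory.Balaban1983to89.Beta
open B4TorusKernel.MultiPeriod (translate)
open B5Prop11Plancherel (fine)
open B6Lemma24Torus (pbox wrap)
open AffineAveraging (Site box toSite)
open AveragingContoursRooted (ctr ctrOff)
open ExpKernelCalculus (MKer)
open OneStepResolventKernel (Fib)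
open Summit.QuantumFields.BalabanUV.Beta.BorderedHessian (stepScale)
open Summit.QuantumFields.BalabanUV.Beta.SymShiftedSpread (bhKStepSh)
open Summit.QuantumFields.BalabanUV.Beta.DshAn1 (Dsh)
open Summit.QuantumFields.BalabanUV.Beta.SymAveragingHessianCounts (symLinKerAt symVhKerAt symVhSAt)
open Summit.QuantumFields.BalabanUV.Beta.CompositeVertexKernelRec (compVhS)
open Summit.QuantumFields.BalabanUV.Beta.CompositeOneShotJets (compV)
open Summit.QuantumFields.BalabanUV.Beta.CompositeOneShotJetData (Roots Pins AN VN)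
open Summit.QuantumFields.BalabanUV.Beta.FP.KernelPeriodisationFib (Idx perF perZ perF_apply perZ_smul perZ_translate_left)
open Summit.QuantumFields.BalabanUV.Beta.FP.KernelPeriodisationFibLoc (dper dper_translate)
open Summit.QuantumFields.BalabanUV.Beta.GAN24.KernelPeriodisation (quo translate_wrap_quo)
open Summit.QuantumFields.BalabanUV.Beta.FP.TorusGaugeCovariance (tgrad)
open Summit.QuantumFields.BalabanUV.Beta.FP.TorusGaugeCovariancePairing (wrapPt wrapPt_coe)
open Summit.QuantumFields.BalabanUV.Beta.FP.TorusGaugeCovarianceCoarse (coarsePt)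
open Summit.QuantumFields.BalabanUV.Beta.FP.TorusCompositeObjects (towerTorus)
open Summit.QuantumFields.BalabanUV.Beta.FP.TorusCompositeObjectsG (QstepSym compRowsSym)
open Summit.QuantumFields.BalabanUV.Beta.FP.TorusCompositeCovariance (itRoot)
open Summit.QuantumFields.BalabanUV.Beta.FP.TorusStepInsertionSym (stepIns₁Sym)
open Summit.QuantumFields.BalabanUV.Beta.FP.TorusCompositeCovarianceOneSym (compIns₁Sym)
open Summit.QuantumFields.BalabanUV.Beta.FP.TorusCompositeCovarianceTwoPolarSym (compIns₁Sym_add compIns₁Sym_smul)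
open Summit.QuantumFields.BalabanUV.Beta.FP.TorusCompositeIndexWardOneSym (compIns₁Sym_pureGauge_fun)
open Summit.QuantumFields.BalabanUV.Beta.FP.TowerWeightWords (card_box_four)
open Summit.QuantumFields.BalabanUV.Beta.FP.TowerHN1Row (map_smul_of_linear)

variable {Lc : ℕ} [NeZero Lc] (M : Fin (3 + 1) → ℕ) [∀ μ, NeZero (M μ)] (n : ℕ) (c : ℝ)

/-! ## §1 v4's 𝔔-side letters ARE leaf-02 C2-Sym's (n+2)-fold composite jet and rows (an2 g66 J-NOTE-4 (a)(e)(b), adapted) -/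

section Letters

variable {κ : Type*}
  -- v4's 𝔔-side letters VERBATIM (`Mc B ↦ M`, `c n ↦ c`, `hv n B ↦ hv`; the source type `κ B ↦ κ`)
  (Q₁₀ : Matrix (↥(pbox (fine Lc M)) × Fin (3 + 1)) (↥(pbox (towerTorus Lc (fine Lc M) (n + 1))) × Fin (3 + 1)) ℝ)
  (hQ₁₀ : Q₁₀ = compRowsSym Lc (fine Lc M) (fun i : ℕ => n + 1 - i) (fun _ : ℕ => ctrOff (3 + 1) Lc) (n + 1))
  (Q₂₀ : Matrix (↥(pbox M) × Fin (3 + 1)) (↥(pbox (fine Lc M)) × Fin (3 + 1)) ℝ)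
  (hQ₂₀ : Q₂₀ = (perF (fine Lc M) (bhKStepSh 3 Lc (Dsh Lc) ((n + 1 - 0)))).submatrix
    (fun a : ((↥(pbox M) × Fin (3 + 1))) => ((coarsePt M Lc a.1, Sum.inr (a.2)) : Idx (fine Lc M) (Fib 3)))
    (fun b : (↥(pbox (fine Lc M)) × Fin (3 + 1)) => ((b.1, Sum.inl b.2) : Idx (fine Lc M) (Fib 3))))
  (hv : (κ → ℝ) → (↥(pbox (towerTorus Lc (fine Lc M) (n + 1))) × Fin (3 + 1) → ℝ))
  (Q₁₁f : (κ → ℝ) → Matrix (↥(pbox (fine Lc M)) × Fin (3 + 1)) (↥(pbox (towerTorus Lc (fine Lc M) (n + 1))) × Fin (3 + 1)) ℝ)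
  (hQ₁₁f : ∀ v, Q₁₁f v = c • compIns₁Sym Lc (fine Lc M) (fun i : ℕ => n + 1 - i) (fun _ : ℕ => ctrOff (3 + 1) Lc) (n + 1) (hv v))
  (Q₂₁f : (κ → ℝ) → Matrix ((↥(pbox M) × Fin (3 + 1))) (↥(pbox (fine Lc M)) × Fin (3 + 1)) ℝ)
  (hQ₂₁f : ∀ v, Q₂₁f v = ∑ a' : (↥(pbox (fine Lc M)) × Fin (3 + 1)), ((c * (((Lc : ℝ) ^ (3 + 1) * stepScale 3 Lc ((n + 1 - 0))) *
      (∏ i ∈ range (n + 1), (stepScale 3 Lc ((n + 1 - (i + 1))) * ((box (3 + 1) Lc).card : ℝ)))⁻¹)) *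
      (compRowsSym Lc (fine Lc M) (fun i : ℕ => n + 1 - i) (fun _ : ℕ => ctrOff (3 + 1) Lc) (n + 1) *ᵥ (hv v)) a') •
      (perF (fine Lc M) (dper (fine Lc M) (symVhSAt (ctr (3 + 1) Lc) 3 Lc rfl a'.2 (a'.1 : Site (3 + 1))))).submatrix
        (fun k : (↥(pbox M) × Fin (3 + 1)) => (((coarsePt M Lc k.1, Sum.inr (k.2)) : Idx (fine Lc M) (Fib 3))))
        (fun b : (↥(pbox (fine Lc M)) × Fin (3 + 1)) => ((b.1, Sum.inl b.2) : Idx (fine Lc M) (Fib 3))))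
  (𝔔₀ : Matrix ((↥(pbox M) × Fin (3 + 1))) (↥(pbox (towerTorus Lc (fine Lc M) (n + 1))) × Fin (3 + 1)) ℝ)
  (h𝔔₀ : Q₂₀ * Q₁₀ = 𝔔₀)
  (𝔔₁f : (κ → ℝ) → Matrix ((↥(pbox M) × Fin (3 + 1))) (↥(pbox (towerTorus Lc (fine Lc M) (n + 1))) × Fin (3 + 1)) ℝ)
  (h𝔔₁ : ∀ v, Q₂₁f v * Q₁₀ + Q₂₀ * Q₁₁f v = 𝔔₁f v)

include hQ₁₀ hQ₂₀ hQ₁₁f hQ₂₁f h𝔔₁ in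
/-- [folklore] **`Qf1_eq_compIns1Sym`** (an2 g66 J-NOTE-4 (a), adapted): the wrapper's 𝔔-side first-order split `h𝔔₁` IS `c •` leaf-02 C2-Sym's (n+2)-fold composite
first-order jet at `lev := fun i => n+1−(i−1)` (top peel `compIns₁Sym_succ` by `rfl`; the re-index `fun k => n+1−(k+1−1)` IS `fun i => n+1−i` definitionally). -/
theorem Qf1_eq_compIns1Sym (v : κ → ℝ) :
    𝔔₁f v = c • compIns₁Sym Lc M (fun i : ℕ => n + 1 - (i - 1)) (fun _ : ℕ => ctrOff (3 + 1) Lc) (n + 1 + 1) (hv v) := by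
  rw [← h𝔔₁, hQ₂₁f, hQ₁₁f, hQ₂₀, hQ₁₀]
  show _ = c • ((((Lc : ℝ) ^ (3 + 1) * stepScale 3 Lc (n + 1 - 0)) *
        (∏ i ∈ range (n + 1), (stepScale 3 Lc (n + 1 - (i + 1)) * ((box (3 + 1) Lc).card : ℝ)))⁻¹) •
          (stepIns₁Sym M Lc ((compRowsSym Lc (fine Lc M) (fun i : ℕ => n + 1 - i) (fun _ : ℕ => ctrOff (3 + 1) Lc) (n + 1)) *ᵥ hv v)
            * compRowsSym Lc (fine Lc M) (fun i : ℕ => n + 1 - i) (fun _ : ℕ => ctrOff (3 + 1) Lc) (n + 1))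
      + QstepSym Lc M (n + 1 - 0) * compIns₁Sym Lc (fine Lc M) (fun i : ℕ => n + 1 - i) (fun _ : ℕ => ctrOff (3 + 1) Lc) (n + 1) (hv v))
  rw [smul_add]
  congr 1
  · rw [smul_smul, stepIns₁Sym, ← Matrix.smul_mul, Finset.smul_sum]
    simp_rw [smul_smul]
  · rw [Matrix.mul_smul]
    rfl

include hQ₁₀ hQ₂₀ h𝔔₀ in
/-- [folklore] **`Q0_eq_compRowsSym`** (J-NOTE-4 (e)): `h𝔔₀ : Q₂₀·Q₁₀ = 𝔔₀` makes `𝔔₀` C2-Sym's `compRowsSym` at the same `lev` and depth (`compRowsSym_succ` is `rfl`). -/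
theorem Q0_eq_compRowsSym : 𝔔₀ = compRowsSym Lc M (fun i : ℕ => n + 1 - (i - 1)) (fun _ : ℕ => ctrOff (3 + 1) Lc) (n + 1 + 1) := by
  rw [← h𝔔₀, hQ₂₀, hQ₁₀]
  rfl

omit [NeZero Lc] [∀ μ, NeZero (M μ)] in
/-- [folklore] (J-NOTE-4 (b)) F4-Sym's unit at that `lev` and depth is `Σ_full = Π_{ℓ<n+2} stepScale 3 Lc ℓ·#B` (pure `Finset` algebra). -/
theorem unit_eq_sigmaFull :
    (∏ i ∈ range (n + 1 + 1), stepScale 3 Lc ((fun i : ℕ => n + 1 - (i - 1)) (i + 1))) * ((box (3 + 1) Lc).card : ℝ) ^ (n + 1 + 1)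
      = ∏ ℓ ∈ range (n + 1 + 1), (stepScale 3 Lc ℓ * ((box (3 + 1) Lc).card : ℝ)) := by
  rw [Finset.prod_mul_distrib, Finset.prod_const, Finset.card_range]
  congr 1
  rw [← Finset.prod_range_reflect (fun ℓ => stepScale 3 Lc ℓ) (n + 1 + 1)]
  refine Finset.prod_congr rfl fun i _ => ?_
  show stepScale 3 Lc (n + 1 - (i + 1 - 1)) = stepScale 3 Lc (n + 1 + 1 - 1 - i)
  congr 1

omit [NeZero Lc] [∀ μ, NeZero (M μ)] in
/-- [folklore] `Σ_full` in the LOCK ROW's currency: `Π_{ℓ<n+2} stepScale 3 Lc ℓ·#B = Π_{ℓ<n+2} stepScale 3 Lc ℓ·Lc⁴` (`#B = Lc⁴`, `TowerWeightWords.card_box_four`). -/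
theorem sigmaFull_card_eq :
    ∏ ℓ ∈ range (n + 1 + 1), (stepScale 3 Lc ℓ * ((box (3 + 1) Lc).card : ℝ)) = ∏ ℓ ∈ range (n + 1 + 1), (stepScale 3 Lc ℓ * (Lc : ℝ) ^ (3 + 1)) := by
  simp_rw [card_box_four]

end Letters

/-! ## §2 The gauge step: the conjugated jet is the composite jet along `hv + tgrad·lv`, hence along `r • colN̂` -/

section Gauge

variable (hc : ctrOff (3 + 1) Lc ∈ box (3 + 1) Lc) {κ : Type*}
  (hv : (κ → ℝ) → (↥(pbox (towerTorus Lc (fine Lc M) (n + 1))) × Fin (3 + 1) → ℝ))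
  (lv : (κ → ℝ) → (↥(pbox (towerTorus Lc (fine Lc M) (n + 1))) → ℝ))
  (𝔔₀ CRS : Matrix ((↥(pbox M) × Fin (3 + 1))) (↥(pbox (towerTorus Lc (fine Lc M) (n + 1))) × Fin (3 + 1)) ℝ)
  (h𝔔₀' : 𝔔₀ = CRS)
  (CI : ((↥(pbox (towerTorus Lc (fine Lc M) (n + 1))) × Fin (3 + 1) → ℝ)) →
    Matrix ((↥(pbox M) × Fin (3 + 1))) (↥(pbox (towerTorus Lc (fine Lc M) (n + 1))) × Fin (3 + 1)) ℝ)
  (𝔔₁f : (κ → ℝ) → Matrix ((↥(pbox M) × Fin (3 + 1))) (↥(pbox (towerTorus Lc (fine Lc M) (n + 1))) × Fin (3 + 1)) ℝ)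
  (h𝔔₁' : ∀ v, 𝔔₁f v = c • CI (hv v))
  (Xbf : (κ → ℝ) → Matrix ((↥(pbox M) × Fin (3 + 1))) ((↥(pbox M) × Fin (3 + 1))) ℝ)
  -- THE INSTANTIATION of R-FP-79's free coarse read-out (J-NOTE-4): the gauge function at the iterated CENTRED root of the coarse slot
  (hXbf : ∀ v, Xbf v = c • Matrix.diagonal (fun a : (↥(pbox M) × Fin (3 + 1)) =>
    lv v (itRoot Lc M (fun _ : ℕ => ctrOff (3 + 1) Lc) (fun _ => hc) (n + 1 + 1) a.1)))
  (𝔔'₁f : (κ → ℝ) → Matrix ((↥(pbox M) × Fin (3 + 1))) (↥(pbox (towerTorus Lc (fine Lc M) (n + 1))) × Fin (3 + 1)) ℝ)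
  (h𝔔'₁f : ∀ v, 𝔔'₁f v = Xbf v * 𝔔₀ + 𝔔₁f v
    + 𝔔₀ * (-(c • Matrix.diagonal (fun b : (↥(pbox (towerTorus Lc (fine Lc M) (n + 1))) × Fin (3 + 1)) => lv v b.1))))

omit [NeZero Lc] [∀ μ, NeZero (M μ)] in
include h𝔔₀' h𝔔₁' hXbf h𝔔'₁f in
/-- [folklore] (an2 g66 J-NOTE-4 (f), source type generic) pure algebra: GIVEN a pure-gauge law `hPG` and additivity `hadd` for an abstract jet `CI` with rows `CRS = 𝔔₀`, the
wrapper's conjugated jet with `Xbf` so instantiated is `c • CI (hv v + tgrad·lv v)`. -/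
theorem Qprime1_eq_jet_along_sum_of_pureGauge
    (hPG : ∀ lam : ↥(pbox (towerTorus Lc (fine Lc M) (n + 1))) → ℝ,
      CI (fun b : ↥(pbox (towerTorus Lc (fine Lc M) (n + 1))) × Fin (3 + 1) =>
            ∑ s : ↥(pbox (towerTorus Lc (fine Lc M) (n + 1))), tgrad (towerTorus Lc (fine Lc M) (n + 1)) (b.1, Sum.inl b.2) s * lam s)
        = Matrix.diagonal (fun a : ↥(pbox M) × Fin (3 + 1) => lam (itRoot Lc M (fun _ : ℕ => ctrOff (3 + 1) Lc) (fun _ => hc) (n + 1 + 1) a.1)) * CRS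
          - CRS * Matrix.diagonal (fun b : ↥(pbox (towerTorus Lc (fine Lc M) (n + 1))) × Fin (3 + 1) => lam b.1))
    (hadd : ∀ h h' : ↥(pbox (towerTorus Lc (fine Lc M) (n + 1))) × Fin (3 + 1) → ℝ, CI (h + h') = CI h + CI h')
    (v : κ → ℝ) :
    𝔔'₁f v = c • CI (hv v + fun b : ↥(pbox (towerTorus Lc (fine Lc M) (n + 1))) × Fin (3 + 1) =>
        ∑ s : ↥(pbox (towerTorus Lc (fine Lc M) (n + 1))), tgrad (towerTorus Lc (fine Lc M) (n + 1)) (b.1, Sum.inl b.2) s * lv v s) := by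
  rw [h𝔔'₁f, hXbf, h𝔔₁', h𝔔₀', hadd, smul_add, hPG (lv v), smul_sub, Matrix.smul_mul, Matrix.mul_neg, Matrix.mul_smul]
  abel

end Gauge

section GaugeSym

variable (hc : ctrOff (3 + 1) Lc ∈ box (3 + 1) Lc) {κ : Type*}
  (hv : (κ → ℝ) → (↥(pbox (towerTorus Lc (fine Lc M) (n + 1))) × Fin (3 + 1) → ℝ))
  (lv : (κ → ℝ) → (↥(pbox (towerTorus Lc (fine Lc M) (n + 1))) → ℝ))
  (𝔔₀ : Matrix ((↥(pbox M) × Fin (3 + 1))) (↥(pbox (towerTorus Lc (fine Lc M) (n + 1))) × Fin (3 + 1)) ℝ)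
  (h𝔔₀' : 𝔔₀ = (compRowsSym Lc M (fun i : ℕ => n + 1 - (i - 1)) (fun _ : ℕ => ctrOff (3 + 1) Lc) (n + 1 + 1) :
      Matrix ((↥(pbox M) × Fin (3 + 1))) (↥(pbox (towerTorus Lc (fine Lc M) (n + 1))) × Fin (3 + 1)) ℝ))
  (𝔔₁f : (κ → ℝ) → Matrix ((↥(pbox M) × Fin (3 + 1))) (↥(pbox (towerTorus Lc (fine Lc M) (n + 1))) × Fin (3 + 1)) ℝ)
  (h𝔔₁' : ∀ v, 𝔔₁f v = c • compIns₁Sym Lc M (fun i : ℕ => n + 1 - (i - 1)) (fun _ : ℕ => ctrOff (3 + 1) Lc) (n + 1 + 1) (hv v))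
  (Xbf : (κ → ℝ) → Matrix ((↥(pbox M) × Fin (3 + 1))) ((↥(pbox M) × Fin (3 + 1))) ℝ)
  (hXbf : ∀ v, Xbf v = c • Matrix.diagonal (fun a : (↥(pbox M) × Fin (3 + 1)) =>
    lv v (itRoot Lc M (fun _ : ℕ => ctrOff (3 + 1) Lc) (fun _ => hc) (n + 1 + 1) a.1)))
  (𝔔'₁f : (κ → ℝ) → Matrix ((↥(pbox M) × Fin (3 + 1))) (↥(pbox (towerTorus Lc (fine Lc M) (n + 1))) × Fin (3 + 1)) ℝ)
  (h𝔔'₁f : ∀ v, 𝔔'₁f v = Xbf v * 𝔔₀ + 𝔔₁f v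
    + 𝔔₀ * (-(c • Matrix.diagonal (fun b : (↥(pbox (towerTorus Lc (fine Lc M) (n + 1))) × Fin (3 + 1)) => lv v b.1))))

include h𝔔₀' h𝔔₁' hXbf h𝔔'₁f in
/-- [folklore] **`Qprime1_eq_compIns1Sym_along_sum`** (an2 g66 J-NOTE-4 (g), adapted): with `Xbf` so instantiated, an2 g66
`TorusCompositeIndexWardOneSym.compIns₁Sym_pureGauge_fun` and leaf-02 `compIns₁Sym_add` turn v4's `h𝔔′₁f` into `𝔔′₁f v = c • compIns₁Sym … (n+2) (hv v + tgrad·lv v)` —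
the conjugation is exactly what removes the direction's exact mode (NO gauge residue). -/
theorem Qprime1_eq_compIns1Sym_along_sum (v : κ → ℝ) :
    𝔔'₁f v = c • compIns₁Sym Lc M (fun i : ℕ => n + 1 - (i - 1)) (fun _ : ℕ => ctrOff (3 + 1) Lc) (n + 1 + 1)
      (hv v + fun b : ↥(pbox (towerTorus Lc (fine Lc M) (n + 1))) × Fin (3 + 1) =>
        ∑ s : ↥(pbox (towerTorus Lc (fine Lc M) (n + 1))), tgrad (towerTorus Lc (fine Lc M) (n + 1)) (b.1, Sum.inl b.2) s * lv v s) :=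
  Qprime1_eq_jet_along_sum_of_pureGauge M n c hc hv lv 𝔔₀ _ h𝔔₀'
    (fun h => compIns₁Sym Lc M (fun i : ℕ => n + 1 - (i - 1)) (fun _ : ℕ => ctrOff (3 + 1) Lc) (n + 1 + 1) h)
    𝔔₁f h𝔔₁' Xbf hXbf 𝔔'₁f h𝔔'₁f
    (fun lam => compIns₁Sym_pureGauge_fun Lc hc (n + 1 + 1) M (fun i : ℕ => n + 1 - (i - 1)) (fun _ : ℕ => ctrOff (3 + 1) Lc) lam)
    (fun h h' => compIns₁Sym_add Lc (n + 1 + 1) M (fun i : ℕ => n + 1 - (i - 1)) (fun _ : ℕ => ctrOff (3 + 1) Lc) h h') v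

end GaugeSym

section Direction

variable {κ : Type*} [Fintype κ] [DecidableEq κ] (yN : κ → Site (3 + 1)) (μN : κ → Fin (3 + 1))
  (hv : (κ → ℝ) → (↥(pbox (towerTorus Lc (fine Lc M) (n + 1))) × Fin (3 + 1) → ℝ))
  (hhvl : ∀ (r : ℝ) (x y : κ → ℝ), hv (r • x + y) = r • hv x + hv y)
  (lv : (κ → ℝ) → ↥(pbox (towerTorus Lc (fine Lc M) (n + 1))) → ℝ)
  (hlv : ∀ (r : ℝ) (x y : κ → ℝ), lv (r • x + y) = r • lv x + lv y)
  (hJW : ∀ (a : κ) (b : ↥(pbox (towerTorus Lc (fine Lc M) (n + 1))) × Fin (3 + 1)), hv (Pi.single a 1) b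
      = perF (towerTorus Lc (fine Lc M) (n + 1)) (AN (Roots.ctr Lc) (n + 1)) (b.1, Sum.inl b.2)
          (wrapPt (towerTorus Lc (fine Lc M) (n + 1)) (((Lc ^ (n + 1 + 1) : ℕ) : ℤ) • yN a), Sum.inr (μN a))
        - ∑ s : ↥(pbox (towerTorus Lc (fine Lc M) (n + 1))), tgrad (towerTorus Lc (fine Lc M) (n + 1)) (b.1, Sum.inl b.2) s * lv (Pi.single a 1) s)
  (r : ℝ) (a : κ)

omit [Fintype κ] in
include hhvl hlv hJW in
/-- [folklore] **`direction_add_exact_eq_smul_col` — (J-W″) AS A SUM**: `hv (r•e_a) + tgrad·lv (r•e_a) = r • colN̂_a` (the `r := 1` letter + homogeneity of `hv`, `lv`). -/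
theorem direction_add_exact_eq_smul_col :
    (hv (r • (Pi.single a (1 : ℝ) : κ → ℝ)) + fun b : ↥(pbox (towerTorus Lc (fine Lc M) (n + 1))) × Fin (3 + 1) =>
        ∑ s : ↥(pbox (towerTorus Lc (fine Lc M) (n + 1))), tgrad (towerTorus Lc (fine Lc M) (n + 1)) (b.1, Sum.inl b.2) s
          * lv (r • (Pi.single a (1 : ℝ) : κ → ℝ)) s)
      = r • fun b : ↥(pbox (towerTorus Lc (fine Lc M) (n + 1))) × Fin (3 + 1) =>
          perF (towerTorus Lc (fine Lc M) (n + 1)) (AN (Roots.ctr Lc) (n + 1)) (b.1, Sum.inl b.2)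
            (wrapPt (towerTorus Lc (fine Lc M) (n + 1)) (((Lc ^ (n + 1 + 1) : ℕ) : ℤ) • yN a), Sum.inr (μN a)) := by
  funext b
  rw [map_smul_of_linear hv hhvl, map_smul_of_linear lv hlv]
  simp only [Pi.add_apply, Pi.smul_apply, smul_eq_mul, hJW a b]
  have hx : ∑ s : ↥(pbox (towerTorus Lc (fine Lc M) (n + 1))), tgrad (towerTorus Lc (fine Lc M) (n + 1)) (b.1, Sum.inl b.2) s * (r * lv (Pi.single a 1) s)
      = r * ∑ s : ↥(pbox (towerTorus Lc (fine Lc M) (n + 1))), tgrad (towerTorus Lc (fine Lc M) (n + 1)) (b.1, Sum.inl b.2) s * lv (Pi.single a 1) s := by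
    rw [Finset.mul_sum]
    exact Finset.sum_congr rfl fun s _ => by ring
  rw [hx]
  ring

end Direction

end Summit.QuantumFields.BalabanUV.Beta.FP.TowerQN1RowJet

end
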